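import Summits.QuantumFields.YangMills.Theorems.UnitScaleTiltHalvingP1FlatPillar
import Summits.QuantumFields.YangMills.Theorems.UnitScaleTiltHalvingP1FlatCoreFrameLinTower
import Summits.QuantumFields.YangMills.Theorems.UnitScaleTiltProp8ChartBridgeAllL
import Summits.QuantumFields.YangMills.Theorems.UnitScaleTiltProp7AxialGauge
import Summits.QuantumFields.YangMills.Theorems.UnitScaleTiltHalvingP1FlatCoreCovariance
import HarnessLib

/-!
# Line H (`BirthV10.stub_halvingStep`), brick J4/J5 junction: the (o)-target dictionary for `DP1Clause`

Crux `stmt-QuantumFields-19200` (`MinimiserStabilityRegPr`), line `birth_v10`, pillar P1♭ (`HalvingP1FlatPillar.P1FlatPillarAt`,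
clause (o) = `DP1Clause`).  The top normalisation (o) of the flat core chart says: the `(K-n)`-fold recomputed-frame ("double-bar")
descent of the charted field `(U♯)^{u⁻¹}` equals, on the interior top bonds of the window `D`, the axial-gauge copy at the top block
`y₀ = iterBlockOf (K-n) x` of the `(K-n)`-fold `ℰp`-average `V̄` of `U` ([Balaban1985Averaging] (8), (92), (97)-(100); [Balaban1985Variational] (156)).

This file is the DICTIONARY the nonlinear top step (J4c) and the extraction (J5) use to hit (o): writing the chart gauge as
`u⁻¹ = h · g` (pre-gauge `g`, correction `h`) and letting `κ_i` be the effective gauges of `h` down the double-bar tower of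
`W₁ := (U♯)^{g}` (`P1FlatCoreFrameLinTower.dbarIterU_gaugeActT_eq_effGauge`),

* `dp1Clause_iff_effGauge` — (o) ⟺ `κ_k(c₋) · W̿₁^{(k)}(c) · κ_k(c₊)⁻¹ = V̄(Γ_{y₀,c₋} ∪ c ∪ Γ_{c₊,y₀})` on interior top bonds (pure algebra);
* `unitsField_toUField_iter_eq_emlIterU` — for a fine-regular field (`PlaqSmall (regThreshold F n K ε₀) U`, `10⁷L³ε₀ ≤ 1`) the guarded
  `ℰp`-averages read in `M₂(ℂ)ˣ` ARE the unguarded iterates `emlIterU i U♯`, `i ≤ K-n` (`Prop8ChartAllL.coe_emlIterU_unitsField_T3_allL`);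
* `dp1Clause_iff_effGauge_axialT` — under the no-wrap condition of the top cube the right side is the axial-gauge action
  `(V̄)^{v₀}(c)`, `v₀ = axialT V̄ y₀` (`B10Eq27TorusAxialLog.holT_contourT_eq_gaugeActT`);
* `dp1Clause_of_effGauge_eq_axialT` — THE TARGET: with the accumulated frames `ν_i` of `W₁` (`Prop8ChartDoubleBar.dbarIterU_eq_gaugeActT_emlIterU`)
  and the descended pre-gauge `g_k = g ∘ emb^k` (`Prop8ChartCovariance.emlIterU_gaugeActT`), (o) FOLLOWS from the single gauge identity
  `κ_k(y) · ν_k(y)⁻¹ · g_k(y) = v₀(y)` at the top sites `y ∈ D.Om (K-n)`.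

No analysis; every step is a rewrite along landed identities.
-/

noncomputable section

open scoped BigOperators Matrix.Norms.L2Operator

namespace Summit.QuantumFields.YangMills.Theorems.P1FlatCoreDP1Target

open Literature.MathematicalPhysics.QuantumFieldTheory.Balaban1983to89
open T4Continuum BlockAveraging ExpMeanLog
open T3ContinuumYM3Torus T3RegularMinimiser
open Literature.MathematicalPhysics.QuantumFieldTheory.Balaban1983to89.T3UnitLawDensityEML (ℰp)
open B5Eq117TorusCarriers (Mk)
open B5Eq118OneStroke (iterBlockOf)
open B5Prop12FieldsLattice (distSite)
open B6SectADomainsV1 (Domains)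
open B10Eq27TorusAxialLog (unitsField toUField gaugeActT gaugeActT_apply holT contourT axialT rel rel_apply holT_contourT_eq_gaugeActT
  val_unitsField norm_holT_contourT_sub_one_le h13_unitsField dist1_plaqHol_toUField unitsField_mem_unitaryUnits)
open B7Prop1Explicit (l1 e treeWord length_treeWord)
open B7Prop1Explicit renaming Site → LSite
open B7Prop2Explicit (unitaryUnits_le_U1)
open B7Prop1Local (InBox)
open T3ConstrainedMinimiser (fibre)
open T3TiltDescent (descendTo)
open Summit.QuantumFields.YangMills.Theorems.FlatCubeSequenceAligned (radM cubeFinM cubeSeqMT3 mem_cubeFinM_iff cubeSeqM_Om_pos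
  natAbs_valMinAbs_sub_le_of_div_eq)
open Summit.QuantumFields.YangMills.Theorems (FlatMinimizerH.le_T3)
open Summit.QuantumFields.YangMills.Theorems.Prop8Chart (emlIterU emlIterU_gaugeActT)
open Summit.QuantumFields.YangMills.Theorems.Prop8ChartDoubleBar (dbarIterU vframeU gaugeActT_gaugeActT gaugeActT_const_one
  dbarIterU_eq_gaugeActT_emlIterU)
open Summit.QuantumFields.YangMills.Theorems.P1FlatCoreCovariance (vframeU_gaugeActT_of_stairConst)
open Summit.QuantumFields.YangMills.Theorems.Prop7AxialGauge (axialT_gaugeActT)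
open Summit.QuantumFields.YangMills.Theorems.HalvingP1FlatPillar (DP1Clause)
open Summit.QuantumFields.YangMills.Theorems.P1FlatCoreFrameLinTower (coe_dbarIterU_gaugeActT_eq_effGauge
  dbarIterU_gaugeActT_eq_effGauge)
open Summit.QuantumFields.YangMills.Theorems.Prop8ChartAllL (coe_emlIterU_unitsField_T3_allL)

variable (F : T3Family) (n K : ℕ)

/-- **(o) THROUGH THE EFFECTIVE GAUGES.**  Write the chart gauge as `u⁻¹ = h·g` and let `κ_i` be the effective gauges of the
correction `h` down the double-bar tower of the pre-gauged field `W₁ = (U♯)^{g}` (recursion of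
`P1FlatCoreFrameLinTower.dbarIterU_gaugeActT_eq_effGauge`).  Then clause (o) reads, bondwise on the interior top bonds of `D`,
`κ_k(c₋) · W̿₁^{(k)}(c) · κ_k(c₊)⁻¹ = V̄(Γ_{y₀,c₋} ∪ c ∪ Γ_{c₊,y₀})`, `k = K-n`.  Pure algebra ((100) conjugation).
[cite: Balaban1985Averaging, (92) p.31, (97)-(100) p.32; Balaban1985Variational, (20) p.281] -/
theorem dp1Clause_iff_effGauge (D : Domains (F.P K)) (x : Site (F.P K) 0)
    (U : GaugeField (F.P K) 0 (Matrix.specialUnitaryGroup (Fin 2) ℂ)) (u : GaugeTransf (F.P K) 0 (Matrix.unitaryGroup (Fin 2) ℂ))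
    (g h : GaugeTransf (F.P K) 0 (Matrix (Fin 2) (Fin 2) ℂ)ˣ) (hug : ∀ s, (Unitary.toUnits (u s))⁻¹ = h s * g s)
    (κ : (i : ℕ) → GaugeTransf (F.P K) i (Matrix (Fin 2) (Fin 2) ℂ)ˣ) (h0 : κ 0 = h)
    (hs : ∀ (i : ℕ) (y : Site (F.P K) (i + 1)),
      κ (i + 1) y = (vframeU (gaugeActT (κ i) (dbarIterU i (gaugeActT g (unitsField (toUField U))))) y)⁻¹ * κ i (emb y) *
        vframeU (dbarIterU i (gaugeActT g (unitsField (toUField U)))) y) :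
    DP1Clause F n K D x U u ↔
      ∀ c : PBond (F.P K) (K - n), c.src ∈ D.Om (K - n) → c.tgt ∈ D.Om (K - n) →
        ((κ (K - n) c.src : (Matrix (Fin 2) (Fin 2) ℂ)ˣ) : Matrix (Fin 2) (Fin 2) ℂ) *
              ((dbarIterU (K - n) (gaugeActT g (unitsField (toUField U))) c : (Matrix (Fin 2) (Fin 2) ℂ)ˣ) :
                Matrix (Fin 2) (Fin 2) ℂ) *
            (((κ (K - n) c.tgt)⁻¹ : (Matrix (Fin 2) (Fin 2) ℂ)ˣ) : Matrix (Fin 2) (Fin 2) ℂ) =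
          ((holT (unitsField (toUField (Averaging.iter (fun i => BlockAveraging.blockAvg (P := F.P K) (j := i) ℰp) (K - n) U)))
              (iterBlockOf (K - n) x) (contourT (iterBlockOf (K - n) x) c) : (Matrix (Fin 2) (Fin 2) ℂ)ˣ) :
            Matrix (Fin 2) (Fin 2) ℂ) := by
  have hfun : (fun s => (Unitary.toUnits (u s))⁻¹) = fun s => h s * g s := funext hug
  have hact : gaugeActT (fun s => (Unitary.toUnits (u s))⁻¹) (unitsField (toUField U)) =
      gaugeActT h (gaugeActT g (unitsField (toUField U))) := by
    rw [hfun, gaugeActT_gaugeActT]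
  unfold DP1Clause
  simp only [hact, coe_dbarIterU_gaugeActT_eq_effGauge _ h κ h0 hs]

/-- **THE GUARDED AVERAGES ARE THE UNGUARDED ITERATES (fine-regular fields).**  For `PlaqSmall (regThreshold F n K ε₀) U` with
`10⁷·L³·ε₀ ≤ 1`, the `i`-fold `ℰp`-block-average of `U` read in `M₂(ℂ)ˣ` is the unguarded iterate `emlIterU i U♯` for every
`i ≤ K-n` — as gauge fields, not only as matrices. [cite: Balaban1985Variational, (156) p.302; Balaban1985Averaging, (19) p.21] -/
theorem unitsField_toUField_iter_eq_emlIterU {ε₀ : ℝ} (hε₀ : 0 < ε₀) (hε : 10 ^ 7 * (F.L : ℝ) ^ 3 * ε₀ ≤ 1)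
    (U : GaugeField (F.P K) 0 (Matrix.specialUnitaryGroup (Fin 2) ℂ)) (hU : PlaqSmall (regThreshold F n K ε₀) U) :
    ∀ i, i ≤ K - n →
      unitsField (toUField (Averaging.iter (fun j => BlockAveraging.blockAvg (P := F.P K) (j := j) ℰp) i U)) =
        emlIterU i (unitsField (toUField U)) := by
  intro i hi
  funext b
  apply Units.ext
  rw [val_unitsField, coe_emlIterU_unitsField_T3_allL F n K hε₀ hε U hU i hi b]
  rfl

/-- **(o) THROUGH THE EFFECTIVE GAUGES AND THE AXIAL GAUGE.**  For a fine-regular field and a top window whose interior bonds do not wrap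
around the top torus seen from `y₀ = iterBlockOf (K-n) x` (hypothesis `hwrap`, the condition of (8)), clause (o) reads
`κ_k(c₋) · W̿₁^{(k)}(c) · κ_k(c₊)⁻¹ = (V̄)^{v₀}(c)`, `V̄ = emlIterU (K-n) U♯`, `v₀ = axialT V̄ y₀`.
[cite: Balaban1985Averaging, (8) p.19, (92) p.31; Balaban1985Variational, (156) p.302] -/
theorem dp1Clause_iff_effGauge_axialT (D : Domains (F.P K)) (x : Site (F.P K) 0)
    (U : GaugeField (F.P K) 0 (Matrix.specialUnitaryGroup (Fin 2) ℂ)) (u : GaugeTransf (F.P K) 0 (Matrix.unitaryGroup (Fin 2) ℂ))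
    (g h : GaugeTransf (F.P K) 0 (Matrix (Fin 2) (Fin 2) ℂ)ˣ) (hug : ∀ s, (Unitary.toUnits (u s))⁻¹ = h s * g s)
    (κ : (i : ℕ) → GaugeTransf (F.P K) i (Matrix (Fin 2) (Fin 2) ℂ)ˣ) (h0 : κ 0 = h)
    (hs : ∀ (i : ℕ) (y : Site (F.P K) (i + 1)),
      κ (i + 1) y = (vframeU (gaugeActT (κ i) (dbarIterU i (gaugeActT g (unitsField (toUField U))))) y)⁻¹ * κ i (emb y) *
        vframeU (dbarIterU i (gaugeActT g (unitsField (toUField U)))) y)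
    {ε₀ : ℝ} (hε₀ : 0 < ε₀) (hε : 10 ^ 7 * (F.L : ℝ) ^ 3 * ε₀ ≤ 1) (hU : PlaqSmall (regThreshold F n K ε₀) U)
    (hwrap : ∀ c : PBond (F.P K) (K - n), c.src ∈ D.Om (K - n) → c.tgt ∈ D.Om (K - n) →
      (rel (iterBlockOf (K - n) x) c.src c.dir + 1) * 2 ≤ ((F.P K).sitesPerDir (K - n) : ℤ)) :
    DP1Clause F n K D x U u ↔
      ∀ c : PBond (F.P K) (K - n), c.src ∈ D.Om (K - n) → c.tgt ∈ D.Om (K - n) →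
        ((κ (K - n) c.src : (Matrix (Fin 2) (Fin 2) ℂ)ˣ) : Matrix (Fin 2) (Fin 2) ℂ) *
              ((dbarIterU (K - n) (gaugeActT g (unitsField (toUField U))) c : (Matrix (Fin 2) (Fin 2) ℂ)ˣ) :
                Matrix (Fin 2) (Fin 2) ℂ) *
            (((κ (K - n) c.tgt)⁻¹ : (Matrix (Fin 2) (Fin 2) ℂ)ˣ) : Matrix (Fin 2) (Fin 2) ℂ) =
          ((gaugeActT (axialT (emlIterU (K - n) (unitsField (toUField U))) (iterBlockOf (K - n) x))
              (emlIterU (K - n) (unitsField (toUField U))) c : (Matrix (Fin 2) (Fin 2) ℂ)ˣ) : Matrix (Fin 2) (Fin 2) ℂ) := by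
  rw [dp1Clause_iff_effGauge F n K D x U u g h hug κ h0 hs, unitsField_toUField_iter_eq_emlIterU F n K hε₀ hε U hU (K - n) le_rfl]
  refine forall_congr' fun c => forall_congr' fun hsrc => forall_congr' fun htgt => ?_
  rw [holT_contourT_eq_gaugeActT _ _ c (hwrap c hsrc htgt)]

/-- **THE (o)-TARGET.**  In the letters of the two previous theorems, with moreover the accumulated frames `ν_i` of `W₁ = (U♯)^{g}`
(`W̿₁^{(i)} = (Ū₁^{(i)})^{ν_i⁻¹}`, (97)-(100)) and the descended pre-gauge `g_i = g ∘ emb^i` (covariance (0.14) of the averages):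
if the effective top gauge `κ_k · ν_k⁻¹ · g_k` IS the axial gauge `v₀ = axialT V̄ y₀` at the top sites of the window, then clause (o)
holds.  This is the equation the top-level nonlinear step has to solve. [cite: Balaban1985Averaging, (8) p.19, (92) p.31, (97)-(100) p.32,
(0.14) p.18; Balaban1985Variational, (20) p.281, (156) p.302] -/
theorem dp1Clause_of_effGauge_eq_axialT (D : Domains (F.P K)) (x : Site (F.P K) 0)
    (U : GaugeField (F.P K) 0 (Matrix.specialUnitaryGroup (Fin 2) ℂ)) (u : GaugeTransf (F.P K) 0 (Matrix.unitaryGroup (Fin 2) ℂ))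
    (g h : GaugeTransf (F.P K) 0 (Matrix (Fin 2) (Fin 2) ℂ)ˣ) (hug : ∀ s, (Unitary.toUnits (u s))⁻¹ = h s * g s)
    (κ : (i : ℕ) → GaugeTransf (F.P K) i (Matrix (Fin 2) (Fin 2) ℂ)ˣ) (h0 : κ 0 = h)
    (hs : ∀ (i : ℕ) (y : Site (F.P K) (i + 1)),
      κ (i + 1) y = (vframeU (gaugeActT (κ i) (dbarIterU i (gaugeActT g (unitsField (toUField U))))) y)⁻¹ * κ i (emb y) *
        vframeU (dbarIterU i (gaugeActT g (unitsField (toUField U)))) y)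
    (ν : (i : ℕ) → Site (F.P K) i → (Matrix (Fin 2) (Fin 2) ℂ)ˣ) (hν0 : ∀ s, ν 0 s = 1)
    (hνs : ∀ (i : ℕ) (y : Site (F.P K) (i + 1)),
      ν (i + 1) y = ν i (emb y) * vframeU (dbarIterU i (gaugeActT g (unitsField (toUField U)))) y)
    (gs : (i : ℕ) → GaugeTransf (F.P K) i (Matrix (Fin 2) (Fin 2) ℂ)ˣ) (hg0 : gs 0 = g)
    (hgs : ∀ (i : ℕ) (y : Site (F.P K) (i + 1)), gs (i + 1) y = gs i (emb y))
    {ε₀ : ℝ} (hε₀ : 0 < ε₀) (hε : 10 ^ 7 * (F.L : ℝ) ^ 3 * ε₀ ≤ 1) (hU : PlaqSmall (regThreshold F n K ε₀) U)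
    (hwrap : ∀ c : PBond (F.P K) (K - n), c.src ∈ D.Om (K - n) → c.tgt ∈ D.Om (K - n) →
      (rel (iterBlockOf (K - n) x) c.src c.dir + 1) * 2 ≤ ((F.P K).sitesPerDir (K - n) : ℤ))
    (hlam : ∀ y : Site (F.P K) (K - n), y ∈ D.Om (K - n) →
      κ (K - n) y * (ν (K - n) y)⁻¹ * gs (K - n) y =
        axialT (emlIterU (K - n) (unitsField (toUField U))) (iterBlockOf (K - n) x) y) :
    DP1Clause F n K D x U u := by
  refine (dp1Clause_iff_effGauge_axialT F n K D x U u g h hug κ h0 hs hε₀ hε hU hwrap).2 fun c hsrc htgt => ?_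
  have hW : gaugeActT g (unitsField (toUField U)) = gaugeActT (gs 0) (unitsField (toUField U)) := by rw [hg0]
  have h1 : dbarIterU (K - n) (gaugeActT g (unitsField (toUField U))) c =
      (ν (K - n) c.src)⁻¹ * (gs (K - n) c.src * emlIterU (K - n) (unitsField (toUField U)) c * (gs (K - n) c.tgt)⁻¹) *
        ν (K - n) c.tgt := by
    rw [dbarIterU_eq_gaugeActT_emlIterU _ ν hν0 hνs (K - n), gaugeActT_apply, inv_inv, hW,
      emlIterU_gaugeActT gs hgs _ (K - n), gaugeActT_apply]
  rw [← Units.val_mul, ← Units.val_mul]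
  congr 1
  rw [h1, gaugeActT_apply, ← hlam c.src hsrc, ← hlam c.tgt htgt]
  group

/-! ## v1.1 — the λ-independent factors removed: constants pass through the effective gauges; the target is the axial gauge of `W̿₁^{(k)}` -/

/-- **CONSTANTS PASS THROUGH THE EFFECTIVE GAUGES.**  If `κ_i` are the effective gauges of `h` down the double-bar tower of `W`
(recursion (97)/(100) with the minimizer frames factored out), then `C·κ_i` are those of the constant multiple `C·h`: a constant gauge
transformation conjugates every stair holonomy, hence the frame `v` ((86) is conjugation-covariant), by the same constant.
[cite: Balaban1985Averaging, (86) p.30, (89) p.31, (97)-(100) p.32] -/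
theorem effGauge_const_mul {P : Params} (W : GaugeField P 0 (Matrix (Fin 2) (Fin 2) ℂ)ˣ)
    (κ : (i : ℕ) → GaugeTransf P i (Matrix (Fin 2) (Fin 2) ℂ)ˣ)
    (hs : ∀ (i : ℕ) (y : Site P (i + 1)),
      κ (i + 1) y = (vframeU (gaugeActT (κ i) (dbarIterU i W)) y)⁻¹ * κ i (emb y) * vframeU (dbarIterU i W) y)
    (C : (Matrix (Fin 2) (Fin 2) ℂ)ˣ) :
    ∀ (i : ℕ) (y : Site P (i + 1)),
      (fun (i : ℕ) (y : Site P i) => C * κ i y) (i + 1) y =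
        (vframeU (gaugeActT ((fun (i : ℕ) (y : Site P i) => C * κ i y) i) (dbarIterU i W)) y)⁻¹ *
          (fun (i : ℕ) (y : Site P i) => C * κ i y) i (emb y) * vframeU (dbarIterU i W) y := by
  intro i y
  have hsplit : gaugeActT (fun y : Site P i => C * κ i y) (dbarIterU i W) =
      gaugeActT (fun _ : Site P i => C) (gaugeActT (κ i) (dbarIterU i W)) := by
    rw [gaugeActT_gaugeActT]
  have hconst : vframeU (gaugeActT (fun _ : Site P i => C) (gaugeActT (κ i) (dbarIterU i W))) y =
      C * vframeU (gaugeActT (κ i) (dbarIterU i W)) y * C⁻¹ :=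
    vframeU_gaugeActT_of_stairConst (fun _ : Site P i => C) _ y fun _ => rfl
  simp only
  rw [hsplit, hconst, hs i y, mul_inv_rev, mul_inv_rev, inv_inv]
  group

/-- **THE DOUBLE-BAR TOP FIELD IS A GAUGE COPY OF THE AVERAGE.**  With the accumulated frames `ν_i` of `W₁ = (U♯)^{g}` and the descended
pre-gauge `g_i`: `V̄ = (W̿₁^{(k)})^{φ}`, `φ = g_k⁻¹·ν_k`, `V̄ = emlIterU k U♯` ((100) and the covariance (0.14) of the averages, composed).
[cite: Balaban1985Averaging, (92) p.31, (97)-(100) p.32, (0.14) p.18] -/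
theorem emlIterU_eq_gaugeActT_dbarIterU {P : Params} (V : GaugeField P 0 (Matrix (Fin 2) (Fin 2) ℂ)ˣ)
    (g : GaugeTransf P 0 (Matrix (Fin 2) (Fin 2) ℂ)ˣ)
    (ν : (i : ℕ) → Site P i → (Matrix (Fin 2) (Fin 2) ℂ)ˣ) (hν0 : ∀ s, ν 0 s = 1)
    (hνs : ∀ (i : ℕ) (y : Site P (i + 1)), ν (i + 1) y = ν i (emb y) * vframeU (dbarIterU i (gaugeActT g V)) y)
    (gs : (i : ℕ) → GaugeTransf P i (Matrix (Fin 2) (Fin 2) ℂ)ˣ) (hg0 : gs 0 = g)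
    (hgs : ∀ (i : ℕ) (y : Site P (i + 1)), gs (i + 1) y = gs i (emb y)) (k : ℕ) :
    emlIterU k V = gaugeActT (fun y : Site P k => (gs k y)⁻¹ * ν k y) (dbarIterU k (gaugeActT g V)) := by
  have hW : gaugeActT g V = gaugeActT (gs 0) V := by rw [hg0]
  rw [dbarIterU_eq_gaugeActT_emlIterU _ ν hν0 hνs k, hW, emlIterU_gaugeActT gs hgs V k, gaugeActT_gaugeActT, gaugeActT_gaugeActT]
  have h1 : (fun x : Site P k => (gs k x)⁻¹ * ν k x * (ν k x)⁻¹ * gs k x) = fun _ => 1 := by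
    funext x; group
  rw [h1, gaugeActT_const_one]

/-- **THE (o)-TARGET, FINAL FORM.**  Chart gauge `u⁻¹ = C · h′ · g` with the pre-gauge `g` (descended `g_i = g ∘ emb^i`), a correction `h′`
with effective gauges `κ′_i` down the double-bar tower of `W₁ = (U♯)^{g}`, and the λ-INDEPENDENT constant `C = g_k(y₀)⁻¹ · ν_k(y₀)`
(`ν` the accumulated frames of `W₁`, `y₀ = iterBlockOf (K-n) x`).  If the top effective gauge of the correction IS the axial gauge of
the double-bar top field, `κ′_k(y) = v₀(W̿₁^{(k)}; y₀, y)` for `y ∈ D.Om (K-n)`, then clause (o) holds.  Both sides of this target are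
`1 + O(small)` for a fine-regular field (pre-gauge (d) of the flat core), so it is a statement about `log κ′_k` — the equation the
top-level nonlinear step solves. [cite: Balaban1985Averaging, (8) p.19, p.24, (92) p.31, (97)-(100) p.32; Balaban1985Variational, (20) p.281,
(156) p.302] -/
theorem dp1Clause_of_effGauge_eq_axialT_dbar (D : Domains (F.P K)) (x : Site (F.P K) 0)
    (U : GaugeField (F.P K) 0 (Matrix.specialUnitaryGroup (Fin 2) ℂ)) (u : GaugeTransf (F.P K) 0 (Matrix.unitaryGroup (Fin 2) ℂ))
    (g h' : GaugeTransf (F.P K) 0 (Matrix (Fin 2) (Fin 2) ℂ)ˣ)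
    (κ' : (i : ℕ) → GaugeTransf (F.P K) i (Matrix (Fin 2) (Fin 2) ℂ)ˣ) (h0' : κ' 0 = h')
    (hs' : ∀ (i : ℕ) (y : Site (F.P K) (i + 1)),
      κ' (i + 1) y = (vframeU (gaugeActT (κ' i) (dbarIterU i (gaugeActT g (unitsField (toUField U))))) y)⁻¹ * κ' i (emb y) *
        vframeU (dbarIterU i (gaugeActT g (unitsField (toUField U)))) y)
    (ν : (i : ℕ) → Site (F.P K) i → (Matrix (Fin 2) (Fin 2) ℂ)ˣ) (hν0 : ∀ s, ν 0 s = 1)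
    (hνs : ∀ (i : ℕ) (y : Site (F.P K) (i + 1)),
      ν (i + 1) y = ν i (emb y) * vframeU (dbarIterU i (gaugeActT g (unitsField (toUField U)))) y)
    (gs : (i : ℕ) → GaugeTransf (F.P K) i (Matrix (Fin 2) (Fin 2) ℂ)ˣ) (hg0 : gs 0 = g)
    (hgs : ∀ (i : ℕ) (y : Site (F.P K) (i + 1)), gs (i + 1) y = gs i (emb y))
    {ε₀ : ℝ} (hε₀ : 0 < ε₀) (hε : 10 ^ 7 * (F.L : ℝ) ^ 3 * ε₀ ≤ 1) (hU : PlaqSmall (regThreshold F n K ε₀) U)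
    (hwrap : ∀ c : PBond (F.P K) (K - n), c.src ∈ D.Om (K - n) → c.tgt ∈ D.Om (K - n) →
      (rel (iterBlockOf (K - n) x) c.src c.dir + 1) * 2 ≤ ((F.P K).sitesPerDir (K - n) : ℤ))
    (hug : ∀ s, (Unitary.toUnits (u s))⁻¹ =
      ((gs (K - n) (iterBlockOf (K - n) x))⁻¹ * ν (K - n) (iterBlockOf (K - n) x)) * h' s * g s)
    (hlam : ∀ y : Site (F.P K) (K - n), y ∈ D.Om (K - n) →
      κ' (K - n) y = axialT (dbarIterU (K - n) (gaugeActT g (unitsField (toUField U)))) (iterBlockOf (K - n) x) y) :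
    DP1Clause F n K D x U u := by
  set C : (Matrix (Fin 2) (Fin 2) ℂ)ˣ := (gs (K - n) (iterBlockOf (K - n) x))⁻¹ * ν (K - n) (iterBlockOf (K - n) x) with hC
  refine dp1Clause_of_effGauge_eq_axialT F n K D x U u g (fun s => C * h' s) hug (fun i y => C * κ' i y)
    (by funext y; simp only [h0']) (effGauge_const_mul _ κ' hs' C) ν hν0 hνs gs hg0 hgs hε₀ hε hU hwrap fun y hy => ?_
  rw [emlIterU_eq_gaugeActT_dbarIterU (unitsField (toUField U)) g ν hν0 hνs gs hg0 hgs (K - n), axialT_gaugeActT, hlam y hy,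
    ← hC, mul_inv_rev, inv_inv]
  simp only [mul_assoc]

/-! ## v1.2 — the no-wrap side condition `hwrap` from the ROOM binder (LEAD-H RULING L-4: `2·ρ + Nr ≤ L^{F.m+n}`) -/

/-- the level-`(K-n)` torus of the member `(F, n, K)` has `2·L^{F.m+n}` sites per direction. [cite: Balaban1985Variational, (144) p.300;
Balaban1984PropagatorsI, (1.18) p.20] -/
theorem sitesPerDir_top_eq (hnK : n ≤ K) : (F.P K).sitesPerDir (K - n) = 2 * F.L ^ (F.m + n) := by
  show 2 * F.L ^ (F.m + K - (K - n)) = 2 * F.L ^ (F.m + n)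
  have : F.m + K - (K - n) = F.m + n := by omega
  rw [this]

/-- **ROOM ⇒ NO WRAP AT THE TOP LEVEL.**  If the inner radius and the big-block size fit in half the top torus, `ρ + M ≤ L^{F.m+n}`, then every
site `y` of the top cube `□_k` (the `M`-saturated ball of radius `ρ` about `y₀ = iterBlockOf (K-n) x`) has relative coordinates with
`2·(|rel y₀ y μ| + 1) ≤ sitesPerDir (K-n)` — the side condition of (8) under which the axial contour of a top bond does not wrap.
[cite: Balaban1985Averaging, (8) p.19; Balaban1985Variational, (144) p.300] -/
theorem two_mul_rel_succ_le_of_room (hnK : n < K) {ρ S M : ℕ} (hM : 1 ≤ M) (x : Site (F.P K) 0)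
    (hroom : ρ + M ≤ F.L ^ (F.m + n)) (y : Site (F.P K) (K - n))
    (hy : y ∈ (cubeSeqMT3 F n K x ρ S M hM).Om (K - n)) (μ : Fin (F.P K).d) :
    (rel (iterBlockOf (K - n) x) y μ + 1) * 2 ≤ ((F.P K).sitesPerDir (K - n) : ℤ) := by
  have hk1 : 1 ≤ K - n := by omega
  have hOm : (cubeSeqMT3 F n K x ρ S M hM).Om (K - n) = cubeFinM x (K - n) ρ S M (K - n) :=
    cubeSeqM_Om_pos x (FlatMinimizerH.le_T3 F n K) ρ S M hM hk1 le_rfl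
  rw [hOm, mem_cubeFinM_iff] at hy
  obtain ⟨y₀, hlab, hdist⟩ := hy
  rw [Nat.sub_self] at hdist
  have h1 : ((y₀ μ - (iterBlockOf (K - n) x) μ).valMinAbs).natAbs ≤ ρ := by
    have hle := Finset.le_sup (f := fun ν : Fin (F.P K).d => ((y₀ ν - (iterBlockOf (K - n) x) ν).valMinAbs).natAbs)
      (Finset.mem_univ μ)
    have hsup : ((Finset.univ.sup fun ν : Fin (F.P K).d => ((y₀ ν - (iterBlockOf (K - n) x) ν).valMinAbs).natAbs : ℕ) : ℝ) ≤
        (ρ : ℝ) := hdist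
    exact_mod_cast (Nat.cast_le.2 hle).trans hsup
  have h2 : ((y μ - y₀ μ).valMinAbs).natAbs ≤ M - 1 := by
    rw [← ZMod.natAbs_valMinAbs_neg, neg_sub]
    exact natAbs_valMinAbs_sub_le_of_div_eq hM (y₀ μ) (y μ) (hlab μ)
  have h3 : (rel (iterBlockOf (K - n) x) y μ).natAbs ≤ ρ + (M - 1) := by
    rw [rel_apply]
    have hsplit : y μ - (iterBlockOf (K - n) x) μ = (y μ - y₀ μ) + (y₀ μ - (iterBlockOf (K - n) x) μ) := by abel
    rw [hsplit]
    refine (ZMod.natAbs_valMinAbs_add_le _ _).trans ((Int.natAbs_add_le _ _).trans ?_)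
    omega
  have hN : ((F.P K).sitesPerDir (K - n) : ℤ) = 2 * (F.L : ℤ) ^ (F.m + n) := by
    rw [sitesPerDir_top_eq F n K hnK.le]; push_cast; ring
  have hL : (ρ : ℤ) + M ≤ (F.L : ℤ) ^ (F.m + n) := by exact_mod_cast hroom
  have habs : rel (iterBlockOf (K - n) x) y μ ≤ (ρ : ℤ) + M - 1 := by
    have := Int.le_natAbs (a := rel (iterBlockOf (K - n) x) y μ)
    omega
  rw [hN]
  omega

/-- **THE `hwrap` OF `dp1Clause_iff_effGauge_axialT` ∕ `dp1Clause_of_effGauge_eq_axialT(_dbar)` FROM ROOM**, in their binder shape.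
[cite: Balaban1985Averaging, (8) p.19; Balaban1985Variational, (144) p.300] -/
theorem hwrap_of_room (hnK : n < K) {ρ S M : ℕ} (hM : 1 ≤ M) (x : Site (F.P K) 0) (hroom : ρ + M ≤ F.L ^ (F.m + n)) :
    ∀ c : PBond (F.P K) (K - n), c.src ∈ (cubeSeqMT3 F n K x ρ S M hM).Om (K - n) →
      c.tgt ∈ (cubeSeqMT3 F n K x ρ S M hM).Om (K - n) →
        (rel (iterBlockOf (K - n) x) c.src c.dir + 1) * 2 ≤ ((F.P K).sitesPerDir (K - n) : ℤ) :=
  fun c hsrc _ => two_mul_rel_succ_le_of_room F n K hnK hM x hroom c.src hsrc c.dir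

/-- **THE SAME FROM THE ROOM BINDER OF RECORD** `2·ρ + Nr ≤ L^{F.m+n}` with a room constant `Nr ≥ M` (the supplier's choice).
[cite: Balaban1985Averaging, (8) p.19; Balaban1985Variational, (144) p.300] -/
theorem hwrap_of_roomBinder (hnK : n < K) {ρ S M Nr : ℕ} (hM : 1 ≤ M) (hNr : M ≤ Nr) (x : Site (F.P K) 0)
    (hroom : 2 * ρ + Nr ≤ F.L ^ (F.m + n)) :
    ∀ c : PBond (F.P K) (K - n), c.src ∈ (cubeSeqMT3 F n K x ρ S M hM).Om (K - n) →
      c.tgt ∈ (cubeSeqMT3 F n K x ρ S M hM).Om (K - n) →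
        (rel (iterBlockOf (K - n) x) c.src c.dir + 1) * 2 ≤ ((F.P K).sitesPerDir (K - n) : ℤ) :=
  hwrap_of_room F n K hnK hM x (by omega)

/-! ## v1.3 — the (o) right side `(V̄♯)^{v₀}(c) = V̄♯(Γ_{y₀,c₋} ∪ c ∪ Γ_{c₊,y₀})` is `1 + O(|c₋ − y₀|₁·ε₁)` from the datum's plaquettes -/

/-- **FIBRE MEMBERSHIP TRANSPORTS THE DATUM'S SMALL PLAQUETTES TO THE TOP AVERAGE**: for `U ∈ fibre V` (the `(K-n)`-fold `ℰp`-average of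
`U` IS `V` up to the level identification `fieldShift`) and `PlaqSmall ε₁ V` (the stub's `Reg7 ε₁ V`), the top average has
`ε₁`-small plaquettes. [cite: Balaban1985Variational, (2) p.278, (7) p.279; Balaban1985UV3, (41) p.266] -/
theorem plaqSmall_iter_of_mem_fibre (hnK : n ≤ K) {ε₁ : ℝ}
    (V : GaugeField (F.P n) 0 (Matrix.specialUnitaryGroup (Fin 2) ℂ)) (U : GaugeField (F.P K) 0 (Matrix.specialUnitaryGroup (Fin 2) ℂ))
    (hUV : U ∈ fibre F ℰp n K hnK V) (hV : PlaqSmall ε₁ V) :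
    PlaqSmall ε₁ (Averaging.iter (fun i => BlockAveraging.blockAvg (P := F.P K) (j := i) ℰp) (K - n) U) := by
  have h : descendTo F ℰp n K hnK U = V := hUV
  have h' : PlaqSmall ε₁ (descendTo F ℰp n K hnK U) := by rw [h]; exact hV
  exact (T3CruxEstimates.plaqSmall_fieldShift F _ ε₁ _).1 h'

/-- **THE (o) RIGHT SIDE IS NEAR `1`**: for `U ∈ fibre V` with `PlaqSmall ε₁ V`, the axial-contour transporter of the top average
`V̄♯ = (Averaging.iter ℰp (K-n) U)♯` around a top bond `c` inside a box about `y₀` (no wrap: `InBox lo hi` for `0`, `c₋ − y₀`,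
`c₋ − y₀ + e_μ`) satisfies `‖V̄♯(Γ_{y₀,c₋} ∪ c ∪ Γ_{c₊,y₀}) − 1‖ ≤ |c₋ − y₀|₁·ε₁` — the right side of `dp1Clause_iff_effGauge` is
`1 + O((ρ+M)·ε₁)` on the top cube (it is `1` on tree bonds and a product of plaquettes of `V̄♯` otherwise).
[cite: Balaban1985Averaging, (8) p.19, pp.24-25; Balaban1985UV3, (27)-(28) p.263] -/
theorem norm_holT_contourT_iter_sub_one_le (hnK : n ≤ K) {ε₁ : ℝ} (hε₁ : 0 ≤ ε₁)
    (V : GaugeField (F.P n) 0 (Matrix.specialUnitaryGroup (Fin 2) ℂ)) (U : GaugeField (F.P K) 0 (Matrix.specialUnitaryGroup (Fin 2) ℂ))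
    (hUV : U ∈ fibre F ℰp n K hnK V) (hV : PlaqSmall ε₁ V)
    (y₀ : Site (F.P K) (K - n)) {lo hi : LSite (F.P K).d} (hlohi : ∀ i, lo i ≤ hi i) (h0 : InBox lo hi 0)
    (c : PBond (F.P K) (K - n)) (hc : InBox lo hi (rel y₀ c.src)) (hce : InBox lo hi (rel y₀ c.src + e c.dir)) :
    ‖((holT (unitsField (toUField (Averaging.iter (fun i => BlockAveraging.blockAvg (P := F.P K) (j := i) ℰp) (K - n) U)))
          y₀ (contourT y₀ c) : (Matrix (Fin 2) (Fin 2) ℂ)ˣ) : Matrix (Fin 2) (Fin 2) ℂ) - 1‖ ≤ l1 (rel y₀ c.src) * ε₁ := by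
  letI : CStarAlgebra (Matrix (Fin 2) (Fin 2) ℂ) := B10Eq29TubeLine.cstarAlgebraMatrix 2
  have hW := plaqSmall_iter_of_mem_fibre F n K hnK V U hUV hV
  refine norm_holT_contourT_sub_one_le hlohi _ (fun b => unitaryUnits_le_U1 (unitsField_mem_unitaryUnits _ b)) y₀
    (h13_unitsField _ y₀ fun z κ μ hκμ _ => ?_) hε₁ h0 c hc hce
  rw [dist1_plaqHol_toUField]
  exact (hW _).le

/-- **THE SAME AT THE (o) BASE POINT** `y₀ = iterBlockOf (K-n) x`, for the interior top bonds of a window `D` whose relative positions lie in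
the box (hypothesis `hbox`, the top-cube geometry): the right side of `dp1Clause_iff_effGauge` is within `l1(rel y₀ c₋)·ε₁` of `1`.
[cite: Balaban1985Averaging, (8) p.19, pp.24-25; Balaban1985Variational, (156) p.302] -/
theorem norm_dp1Rhs_sub_one_le (hnK : n ≤ K) {ε₁ : ℝ} (hε₁ : 0 ≤ ε₁) (D : Domains (F.P K)) (x : Site (F.P K) 0)
    (V : GaugeField (F.P n) 0 (Matrix.specialUnitaryGroup (Fin 2) ℂ)) (U : GaugeField (F.P K) 0 (Matrix.specialUnitaryGroup (Fin 2) ℂ))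
    (hUV : U ∈ fibre F ℰp n K hnK V) (hV : PlaqSmall ε₁ V)
    {lo hi : LSite (F.P K).d} (hlohi : ∀ i, lo i ≤ hi i) (h0 : InBox lo hi 0)
    (hbox : ∀ c : PBond (F.P K) (K - n), c.src ∈ D.Om (K - n) → c.tgt ∈ D.Om (K - n) →
      InBox lo hi (rel (iterBlockOf (K - n) x) c.src) ∧ InBox lo hi (rel (iterBlockOf (K - n) x) c.src + e c.dir)) :
    ∀ c : PBond (F.P K) (K - n), c.src ∈ D.Om (K - n) → c.tgt ∈ D.Om (K - n) →
      ‖((holT (unitsField (toUField (Averaging.iter (fun i => BlockAveraging.blockAvg (P := F.P K) (j := i) ℰp) (K - n) U)))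
            (iterBlockOf (K - n) x) (contourT (iterBlockOf (K - n) x) c) : (Matrix (Fin 2) (Fin 2) ℂ)ˣ) : Matrix (Fin 2) (Fin 2) ℂ) - 1‖ ≤
        l1 (rel (iterBlockOf (K - n) x) c.src) * ε₁ :=
  fun c hsrc htgt => norm_holT_contourT_iter_sub_one_le F n K hnK hε₁ V U hUV hV _ hlohi h0 c (hbox c hsrc htgt).1 (hbox c hsrc htgt).2

/-! ## v1.4 — the (o) datum `t = −i·log v₀(W̿₁^{(k)}; y₀, y)` is small when the double-bar top field is near `1` along the comb -/

/-- **COMB TRANSPORTERS OF A NEAR-FLAT FIELD**: if every bond on the comb `Γ_{y₀,y}` carries a variable within `δ` of `1` and the comb has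
at most `m` steps with `4·m·δ ≤ 1`, then `‖v₀(X; y₀, y) − 1‖ ≤ 4·m·δ` (`axialT X y₀ y = X(Γ_{y₀,y})`; zeroth order of
✓`Prop8ChartTransport.norm_holT_sub_one_sub_walkSum_le_of_length_le`). [cite: Balaban1985Averaging, p.24, (122)-(123) p.36] -/
theorem norm_axialT_sub_one_le {P : Params} {j : ℕ} {𝔸 : Type*} [NormedRing 𝔸] [NormOneClass 𝔸] (X : GaugeField P j 𝔸ˣ)
    (y₀ y : Site P j) {δ : ℝ} (hδ : 0 ≤ δ) {m : ℕ} (hm1 : 1 ≤ m) (hmδ : 4 * (m : ℝ) * δ ≤ 1)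
    (hlen : l1 (rel y₀ y) ≤ m)
    (h : ∀ st ∈ walk y₀ (treeWord (rel y₀ y)), ‖((X st.bond : 𝔸ˣ) : 𝔸) - 1‖ ≤ δ) :
    ‖((axialT X y₀ y : 𝔸ˣ) : 𝔸) - 1‖ ≤ 4 * m * δ := by
  unfold axialT
  exact (Prop8Chart.norm_holT_sub_one_sub_walkSum_le_of_length_le hδ hm1 hmδ (treeWord (rel y₀ y)) y₀
    (by rw [length_treeWord]; exact_mod_cast hlen) h).1

/-- **THE (o) DATUM IS SMALL**: with `t(y) := log v₀(X; y₀, y)`, `‖t(y)‖ ≤ 8·m·δ` under the same hypotheses and `8·m·δ ≤ 1`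
(`‖log Z‖ ≤ 2‖Z − 1‖`, ✓`MatrixLog.norm_mlog_le_two_mul`); used with `X := dbarIterU (K-n) W₁`, `W₁` the charted iterate
(`‖X(c) − 1‖ ≤ 2·Lᵏ·s₀` on the top cube, ✓`Prop8ChartDoubleBar.norm_dbarIterU_sub_one_le_two_mul`), `m := 3(ρ+M)`.
[cite: Balaban1985Averaging, p.24, (122)-(123) p.36; Balaban1985Variational, (156) p.302] -/
theorem norm_mlog_axialT_le {P : Params} {j : ℕ} {𝔸 : Type*} [NormedRing 𝔸] [NormOneClass 𝔸] [NormedAlgebra ℂ 𝔸] [CompleteSpace 𝔸]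
    (X : GaugeField P j 𝔸ˣ) (y₀ y : Site P j) {δ : ℝ} (hδ : 0 ≤ δ) {m : ℕ} (hm1 : 1 ≤ m) (hmδ : 8 * (m : ℝ) * δ ≤ 1)
    (hlen : l1 (rel y₀ y) ≤ m)
    (h : ∀ st ∈ walk y₀ (treeWord (rel y₀ y)), ‖((X st.bond : 𝔸ˣ) : 𝔸) - 1‖ ≤ δ) :
    ‖MatrixLog.mlog ((axialT X y₀ y : 𝔸ˣ) : 𝔸)‖ ≤ 8 * m * δ := by
  have h1 := norm_axialT_sub_one_le X y₀ y hδ hm1 (by linarith [show (0:ℝ) ≤ 4 * m * δ by positivity]) hlen h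
  have h2 : ‖((axialT X y₀ y : 𝔸ˣ) : 𝔸) - 1‖ ≤ 1 / 2 := by linarith
  calc ‖MatrixLog.mlog ((axialT X y₀ y : 𝔸ˣ) : 𝔸)‖ ≤ 2 * ‖((axialT X y₀ y : 𝔸ˣ) : 𝔸) - 1‖ := MatrixLog.norm_mlog_le_two_mul h2
    _ ≤ 8 * m * δ := by linarith

end Summit.QuantumFields.YangMills.Theorems.P1FlatCoreDP1Target

end
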